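import Summits.BirchSwinnertonDyer.BirchSwinnertonDyer.Theorems.GenusKolyvaginAtTwoVisiblePairAtTwoShallowExactnessOfH2
import Summits.BirchSwinnertonDyer.Rank1Residual.X11b.CongruentSelmerTransferBounds
import Summits.BirchSwinnertonDyer.BirchSwinnertonDyer.Theorems.SchneiderFreeAdditiveX3PoitouTateReciprocitySumHolds
import Summits.BirchSwinnertonDyer.Rank1Residual.GaloisImage.LocalEulerPoincareCharacteristicHolds
import HarnessLib

/-!
# Route `GenusKolyvaginAtTwo`, crux `KolyvaginExactAtTwo` (22137) → Q3-inner (24882 / 27720):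
# the AUXILIARY CLASS of McCallum Prop. 5.2 EXISTS over `ℚ` (Lemma 5.3 (2) at `p = 2`, `S = {ℓ₀}`)

Seat `bsd-line-gk2-p2` g11 (cell `bsd-f1-sign2`). THEOREMS ONLY (no definition, no named fact, no `sorry`).

McCallum's deepening argument (Prop. 5.2, formalised in `…VisiblePairAtTwoDeepening`,
`…ShallowExactness`, `…ShallowExactnessOfH2`) uses an auxiliary class `c ∈ H¹(ℚ, E[2])` with `c ≠ 0` and
`c_v ∈ δ(E(ℚ_v))` for every place `v ≠ v_{ℓ₀}` (Lemma 5.3 (2) with `S = ∅`, `l = ℓ₀`; McCallum: "the proof is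
a straightforward modification of [4, Prop. 2.1]", i.e. a Poitou–Tate count). Here it is PROVED for the
instance `VisiblePairAtTwo` from the tree's Poitou–Tate machinery:

* `exists_ne_zero_mem_kummerRelaxed_singleton` — for any elliptic curve `E/ℚ` and any finite place `w₀` with
  `#E(ℚ_{w₀})[p] ≠ 1` (any prime `p`), the Kummer Selmer structure RELAXED at `w₀` has a class outside the STRICT
  one (hence nonzero): the index `[H¹_{𝓚^{w₀}} : H¹_{𝓚_{w₀}}] = #E(ℚ_{w₀})[p] · #(ℤ_{w₀}/p)` (Mazur–Rubin 2010
  Lemma 3.2 in index form,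
  `X11b.CongruentTransfer.relIndex_kummerStrict_kummerRelaxed_singleton_eq_of_facts`, fed with the tree
  theorems `poitouTate_selmerStructure_duality_real_holds` (Poitou–Tate with real places) and
  `localEulerPoincareCharacteristic_holds` (Tate's `χ`)) is then `≠ 1`, so the relaxed group is not contained
  in the strict one; bridges `mem_selmerLocalKer_{adicCompletion,completion}_of_mem_kummerRelaxed` to the
  `selmerLocalKer` currency;
* `exists_aux_class` — in the instance's vocabulary: for a Kolyvagin prime `ℓ₀` of the bottom level
  (`kolPrime W K 1 ℓ₀`; `#E(ℚ_{ℓ₀})[2] = 2` by `ReductionCyclic.natCard_ker_zsmul_adicCompletion_two_pow_eq`)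
  there is `u : H¹(ℚ, E[2])`, `u ≠ 0`, with `u ∈ loc₁ W 1 v` for every place `v ≠ pl ℓ₀`;
* `selmer_eq_and_card_selmer_twin_eq_of_kolPrime` — the capstone `…_of_shallow_kolPrime` of
  `…ShallowExactnessOfH2` with the auxiliary-class binders `(u) (hu0) (hu)` DISCHARGED.

What remains displayed in the capstone is listed in its docstring (Cassels–Tate data over `ℚ`, `hcsupp`,
`3 M₀ ≤ M`, the level-`2` classes `y₀, uu, w` with Lemma 4.3 / Prop. 4.4 (Q2 at level `2`) / Lemma 4.6, and the
`Input` record of gk2-p3). BSD is not proved by any of this.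

References: [McCallumLMS1991] W. G. McCallum, *Kolyvagin's work on Shafarevich–Tate groups*, LMS LNS 153
(1991), Prop. 5.2 and Lemma 5.3 (pp. 308–310); [MazurRubin2010] B. Mazur, K. Rubin, Invent. Math. 181 (2010),
Lemma 3.2 (arXiv:0904.3709 p. 10); [MilneADT2006] J. S. Milne, *Arithmetic Duality Theorems*, I Thm. 4.10, I §6.
-/

set_option linter.dupNamespace false -- tree convention: `Summit.BirchSwinnertonDyer.BirchSwinnertonDyer.Theorems` (summit = sub-problem)
set_option autoImplicit false

noncomputable section

open scoped Classical

namespace Summit.BirchSwinnertonDyer.BirchSwinnertonDyer.Theorems.GenusExact.VisiblePairAtTwo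

open WeierstrassCurve NumberField IsDedekindDomain Field Finset Rat.HeightOneSpectrum
open Literature.NumberTheory.EllipticCurves Literature.NumberTheory.GaloisRepresentations
open Literature.NumberTheory.GaloisCohomology
open Literature.NumberTheory.EllipticCurves.KolyvaginDescent
open Summit.BirchSwinnertonDyer.Rank1Residual

/-! ## §1. A nonzero class in the Kummer structure relaxed at one place (any `E/ℚ`) -/

/-- **Lemma 5.3 (2) of McCallum with `S = ∅` — a class of `H¹(ℚ, E[p])` Selmer off one finite place and not
strict there.** For an elliptic curve `E/ℚ` (model `V`), a prime `p` and a finite place `w₀` with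
`#E(ℚ_{w₀})[p] ≠ 1`, the Selmer group of the Kummer structure made `⊤` at `w₀` contains a class outside the one
made `⊥` at `w₀` — in particular a NONZERO class. Proof: `[relaxed : strict] = #E(ℚ_{w₀})[p] · #(ℤ_{w₀}/p) ≠ 1`
(Mazur–Rubin Lemma 3.2 in index form, from Poitou–Tate with real places and Tate's local Euler characteristic,
both theorems of the tree). [cite: McCallumLMS1991, Lemma 5.3 (2) (p. 310)]
[cite: MazurRubin2010, Lemma 3.2 (arXiv:0904.3709 p. 10)] [cite: MilneADT2006, Ch. I, Thm. 4.10] -/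
theorem exists_ne_zero_mem_kummerRelaxed_singleton (V : WeierstrassCurve ℚ) [V.IsElliptic] (p : ℕ)
    [hp : Fact p.Prime] (w₀ : HeightOneSpectrum (𝓞 ℚ))
    (hker : Nat.card (nsmulAddMonoidHom p : (V.baseChange (w₀.adicCompletion ℚ)).toAffine.Point →+ _).ker ≠ 1) :
    ∃ u ∈ (X11b.KummerPT.kummerRelaxed V p {(Sum.inr w₀ : Place ℚ)}).selmerGroup,
      u ∉ (X11b.KummerPT.kummerStrict V p {(Sum.inr w₀ : Place ℚ)}).selmerGroup := by
  have hidx := X11b.CongruentTransfer.relIndex_kummerStrict_kummerRelaxed_singleton_eq_of_facts V p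
    (SchneiderFreeAdditiveX3.PoitouTateReduction.poitouTate_selmerStructure_duality_real_holds (K := ℚ))
    (fun v =>
      haveI : CharZero (v.adicCompletion ℚ) := charZero_of_injective_algebraMap (algebraMap ℚ _).injective
      localEulerPoincareCharacteristic_holds (v.adicCompletion ℚ)) w₀
  have hnle : ¬ (X11b.KummerPT.kummerRelaxed V p {(Sum.inr w₀ : Place ℚ)}).selmerGroup ≤
      (X11b.KummerPT.kummerStrict V p {(Sum.inr w₀ : Place ℚ)}).selmerGroup := by
    intro hle
    rw [AddSubgroup.relIndex_eq_one.mpr hle] at hidx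
    exact hker (Nat.eq_one_of_mul_eq_one_right hidx.symm)
  exact SetLike.not_le_iff_exists.mp hnle

/-- A class outside the strict Selmer group is nonzero. [folklore] -/
theorem ne_zero_of_not_mem_kummerStrict (V : WeierstrassCurve ℚ) [V.IsElliptic] (p : ℕ) [Fact p.Prime]
    (S : Finset (Place ℚ)) {u : galoisCohomology (V.torsionGaloisModule ((p : ℕ) : ℤ)) 1}
    (hu : u ∉ (X11b.KummerPT.kummerStrict V p S).selmerGroup) : u ≠ 0 := by
  rintro rfl
  exact hu (zero_mem _)

/-- **Membership in the relaxed structure off `S` is the Selmer local condition there** (bridge from the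
`SelmerStructure` currency of X11b to the `selmerLocalKer` currency of `VisiblePairAtTwo`). [folklore] -/
theorem mem_selmerLocalKer_of_mem_kummerRelaxed (V : WeierstrassCurve ℚ) [V.IsElliptic] (p : ℕ) [Fact p.Prime]
    (S : Finset (Place ℚ)) {u : galoisCohomology (V.torsionGaloisModule ((p : ℕ) : ℤ)) 1}
    (hu : u ∈ (X11b.KummerPT.kummerRelaxed V p S).selmerGroup) {v : Place ℚ} (hv : v ∉ S) :
    u ∈ selmerLocalKer V (Place.Completion v) ((p : ℕ) : ℤ) := by
  have h := (DiscreteGaloisModule.SelmerStructure.mem_selmerGroup_iff _ _).mp hu v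
  rw [X11b.KummerPT.kummerRelaxed_of_not_mem V p S hv, ← AddSubgroup.mem_comap,
    WeierstrassCurve.comap_localization_kummerSelmerStructure] at h
  exact h

/-- Finite-place form of `mem_selmerLocalKer_of_mem_kummerRelaxed` (completion `ℚ_w`). [folklore] -/
theorem mem_selmerLocalKer_adicCompletion_of_mem_kummerRelaxed (V : WeierstrassCurve ℚ) [V.IsElliptic] (p : ℕ)
    [Fact p.Prime] (S : Finset (Place ℚ)) {u : galoisCohomology (V.torsionGaloisModule ((p : ℕ) : ℤ)) 1}
    (hu : u ∈ (X11b.KummerPT.kummerRelaxed V p S).selmerGroup) {w : HeightOneSpectrum (𝓞 ℚ)}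
    (hw : (Sum.inr w : Place ℚ) ∉ S) :
    u ∈ selmerLocalKer V (w.adicCompletion ℚ) ((p : ℕ) : ℤ) := by
  have h := mem_selmerLocalKer_of_mem_kummerRelaxed V p S hu hw
  rwa [WeierstrassCurve.selmerLocalKer_completion_inr] at h

/-- Infinite-place form of `mem_selmerLocalKer_of_mem_kummerRelaxed` (completion `ℚ_σ = ℝ`). [folklore] -/
theorem mem_selmerLocalKer_completion_of_mem_kummerRelaxed (V : WeierstrassCurve ℚ) [V.IsElliptic] (p : ℕ)
    [Fact p.Prime] (S : Finset (Place ℚ)) {u : galoisCohomology (V.torsionGaloisModule ((p : ℕ) : ℤ)) 1}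
    (hu : u ∈ (X11b.KummerPT.kummerRelaxed V p S).selmerGroup) {σ : InfinitePlace ℚ}
    (hσ : (Sum.inl σ : Place ℚ) ∉ S) :
    u ∈ selmerLocalKer V σ.Completion ((p : ℕ) : ℤ) := by
  have h := mem_selmerLocalKer_of_mem_kummerRelaxed V p S hu hσ
  rwa [WeierstrassCurve.selmerLocalKer_completion_inl] at h

/-! ## §2. The auxiliary class of the instance `VisiblePairAtTwo` -/

variable (W : WeierstrassCurve ℚ) [W.IsElliptic] [W.IsGloballyMinimal] (K : Type) [Field K] [NumberField K]

/-- **The auxiliary class `u` of McCallum Prop. 5.2 EXISTS for the instance**: for a Kolyvagin prime `ℓ₀` of the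
bottom level (`kolPrime W K 1 ℓ₀`: odd, good, `Frob_{ℓ₀} = Frob_∞` on `E[2]`, index `≥ 1`) there is a class
`u ∈ H¹(ℚ, E[2])`, `u ≠ 0`, satisfying the Selmer condition `loc₁ W 1 v` at every place `v ≠ pl ℓ₀`.
Ingredients: `#E(ℚ_{ℓ₀})[2] = 2` (`ReductionCyclic.natCard_ker_zsmul_adicCompletion_two_pow_eq`, from `Δ < 0`
and the Frobenius condition) and `exists_ne_zero_mem_kummerRelaxed_singleton`.
[cite: McCallumLMS1991, Lemma 5.3 (2) (p. 310) and Prop. 5.2 (7)–(8) (p. 309)] -/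
theorem exists_aux_class (hΔ : W.Δ < 0) {ℓ₀ : ℕ} (hkol₀ : kolPrime W K 1 ℓ₀) :
    ∃ u : galH1Torsion W (lvl 1), u ≠ 0 ∧ ∀ v, v ≠ pl ℓ₀ → u ∈ loc₁ W 1 v := by
  obtain ⟨hℓ₀, hℓ₀2, -, hgood, -, hF2, hidx, -⟩ := hkol₀
  haveI : Fact ℓ₀.Prime := ⟨hℓ₀⟩
  haveI : Fact (Nat.Prime (2 ^ 1)) := ⟨by rw [pow_one]; exact Nat.prime_two⟩
  set w₀ : HeightOneSpectrum (𝓞 ℚ) := primesEquiv.symm ⟨ℓ₀, hℓ₀⟩ with hw₀def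
  have hℓw : (ℓ₀ : 𝓞 ℚ) ∈ w₀.asIdeal := natCast_mem_primesEquiv_symm hℓ₀
  have hker : Nat.card (nsmulAddMonoidHom (2 ^ 1) :
      (W.baseChange (w₀.adicCompletion ℚ)).toAffine.Point →+ _).ker ≠ 1 := by
    rw [← zsmulAddGroupHom_natCast,
      ReductionCyclic.natCard_ker_zsmul_adicCompletion_two_pow_eq W hΔ hℓ₀2 hgood hF2 hℓw (M := 1) hidx]
    norm_num
  obtain ⟨u, hurel, hustr⟩ := exists_ne_zero_mem_kummerRelaxed_singleton W (2 ^ 1) w₀ hker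
  refine ⟨u, ne_zero_of_not_mem_kummerStrict W (2 ^ 1) _ hustr, fun v hv ↦ ?_⟩
  rw [pl_of_prime hℓ₀] at hv
  rcases v with w | σ
  · -- a finite place `w ≠ w₀`
    have hw : w ≠ w₀ := fun h ↦ hv (by rw [h])
    have hS : (Sum.inr w : Place ℚ) ∉ ({(Sum.inr w₀ : Place ℚ)} : Finset (Place ℚ)) := by
      rw [Finset.mem_singleton]
      exact fun h ↦ hw (Sum.inr_injective h)
    rw [mem_loc₁_inl_iff]
    exact mem_selmerLocalKer_adicCompletion_of_mem_kummerRelaxed W (2 ^ 1) _ hurel hS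
  · -- an infinite place
    have hS : (Sum.inl σ : Place ℚ) ∉ ({(Sum.inr w₀ : Place ℚ)} : Finset (Place ℚ)) := by
      rw [Finset.mem_singleton]
      exact Sum.inl_ne_inr
    rw [mem_loc₁_inr_iff]
    exact mem_selmerLocalKer_completion_of_mem_kummerRelaxed W (2 ^ 1) _ hurel hS

/-! ## §3. The capstone with the auxiliary class discharged -/

variable {W} {K} {M : ℕ} {θ : K} {hθ : θ ∉ Set.range (algebraMap ℚ K)}
  {hθsq : θ ^ 2 = algebraMap ℚ K ((NumberField.discr K : ℤ) : ℚ)}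

/-- **Exactness of `visiblePair I` from a SHALLOW Kolyvagin prime, with visibility (H2) AND the auxiliary
class both discharged.** Same conclusion as `selmer_eq_and_card_selmer_twin_eq_of_shallow_kolPrime`
(`Sel_{2^M}(E/ℚ) = ℤ·x` and `#Sel_{2^M}(E^{(d_K)}/ℚ) = 2^{2 M₀}`); the binders `(u) (hu0) (hu)` of that theorem
are now supplied by `exists_aux_class`. Still displayed: the Cassels–Tate data `P₁ P₂ halt hPx hnd hCTV` over
`ℚ`, the support conditions `hcsupp₁ hcsupp₂`, `3 M₀ ≤ M`, the bottom-level classes `y₀` (Selmer, `≠ 0`),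
`uu`, `w` with Lemma 4.3 (`h43`), Prop. 4.4 at level `2` (`h44sel`, `h44ord`) and Lemma 4.6 (`hι`), and the
`Input` record `I` of gk2-p3. [cite: McCallumLMS1991, Prop. 5.2 (pp. 308–310), Lemma 5.3, Thm. 5.4] -/
theorem selmer_eq_and_card_selmer_twin_eq_of_kolPrime (I : Input W K M hθ hθsq) (hcm : ¬ W.HasCM)
    (hΔ : W.Δ < 0) (hK : IsImaginaryQuadratic K) (hodd : Odd (NumberField.discr K))
    (hns : ¬ IsSquare ((NumberField.discr K : ℚ) * -|W.Δ|))
    (hρ : ∀ n : ℕ, W.HasSurjectiveModNGaloisRep (2 ^ n : ℕ)) [(twin W K).IsElliptic] (hM : 1 ≤ M)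
    (P₁ : (visiblePair I).Sel₁ →+ (visiblePair I).Sel₁ →+ AddCircle (1 : ℚ)) (halt₁ : ∀ z, P₁ z z = 0)
    (hPx : ∀ t, P₁ ⟨(visiblePair I).x, (visiblePair I).x_mem⟩ t = 0)
    (hnd₁ : ∀ z : (visiblePair I).Sel₁, (∀ t, P₁ z t = 0) →
      (z : galH1Torsion W (lvl M)) ∈ AddSubgroup.zmultiples (visiblePair I).x)
    (P₂ : (visiblePair I).Sel₂ →+ (visiblePair I).Sel₂ →+ AddCircle (1 : ℚ)) (halt₂ : ∀ z, P₂ z z = 0)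
    (hnd₂ : ∀ z : (visiblePair I).Sel₂, (∀ t, P₂ z t = 0) → z = 0)
    (hCTV : ∀ ℓ m : ℕ, (visiblePair I).Kol ℓ → KolSupp (visiblePair I).Kol (ℓ * m) → ¬ ℓ ∣ m →
      ∀ (j N a b : ℕ) (t : galH1Torsion W (lvl M) × galH1Torsion (twin W K) (lvl M))
        (ht : t ∈ (visiblePair I).toVisibleSplit.Sel)
        (hz : (((visiblePair I).p : ℤ) ^ j) • (visiblePair I).toVisibleSplit.c (ℓ * m) ∈
          (visiblePair I).toVisibleSplit.Sel),
      (((visiblePair I).p : ℤ) ^ N) • t = 0 →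
      t ∈ (visiblePair I).toVisibleSplit.part (1 * (-1) ^ (ℓ * m).primeFactors.card) →
      (∀ q ∈ m.primeFactors, t ∈ (visiblePair I).toVisibleSplit.A q) →
      (visiblePair I).M - (visiblePair I).M₀ ≤ j → N + (visiblePair I).M₀ ≤ (visiblePair I).M → N ≤ j →
      a + b + 1 = N →
      (((visiblePair I).p : ℤ) ^ (a + (j - N))) • (visiblePair I).toVisibleSplit.c m ∉
        (visiblePair I).toVisibleSplit.A ℓ →
      (((visiblePair I).p : ℤ) ^ b) • t ∉ (visiblePair I).toVisibleSplit.A ℓ →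
      (visiblePair I).prodPairing P₁ P₂ ⟨_, hz⟩ ⟨t, ht⟩ ≠ 0)
    (hcsupp₁ : ∀ n, KolSupp (visiblePair I).Kol n → Even n.primeFactors.card →
      ∀ v, (∀ q, (visiblePair I).Kol q → v ≠ (visiblePair I).pl q) → (visiblePair I).c₁ n ∈ (visiblePair I).Loc₁ v)
    (hcsupp₂ : ∀ n, KolSupp (visiblePair I).Kol n → Odd n.primeFactors.card →
      ∀ v, (∀ q, (visiblePair I).Kol q → v ≠ (visiblePair I).pl q) → (visiblePair I).c₂ n ∈ (visiblePair I).Loc₂ v)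
    (h3 : 3 * I.M₀ ≤ M)
    -- the shallow certificate and its level-`2` data (no visibility hypothesis, no auxiliary class)
    {ℓ₀ : ℕ} (hkol₀ : kolPrime W K 1 ℓ₀) (y₀ : galH1Torsion (twin W K) (lvl 1)) (hy0 : y₀ ≠ 0)
    (hy : y₀ ∈ selmerGroup (twin W K) (lvl 1))
    (uu : ℕ → galH1Torsion W (lvl 1)) (w : ℕ → galH1Torsion (twin W K) (lvl 1))
    (h43 : ∀ ℓ, kolPrime W K M ℓ → ℓ ≠ ℓ₀ → ∀ v, v ≠ pl ℓ₀ → v ≠ pl ℓ → uu ℓ ∈ loc₁ W 1 v)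
    (h44sel : ∀ ℓ, kolPrime W K M ℓ → ℓ ≠ ℓ₀ → (uu ℓ ∈ loc₁ W 1 (pl ℓ) ↔ y₀ ∈ a₂ W K 1 ℓ))
    (h44ord : ∀ ℓ, kolPrime W K M ℓ → ℓ ≠ ℓ₀ → (uu ℓ ∈ a₁ W 1 ℓ₀ ↔ w ℓ ∈ a₂ W K 1 ℓ₀))
    (hι : ∀ ℓ, kolPrime W K M ℓ →
      torsionH1OfDvd (twin W K) (lvl_one_dvd_lvl hM) (w ℓ) = ((2 : ℤ) ^ (M - 1)) • I.c₂ ℓ) :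
    selmerGroup W (lvl M) = AddSubgroup.zmultiples I.x ∧
      Nat.card (selmerGroup (twin W K) (lvl M)) = 2 ^ (2 * I.M₀) := by
  obtain ⟨u, hu0, hu⟩ := exists_aux_class W K hΔ hkol₀
  exact selmer_eq_and_card_selmer_twin_eq_of_shallow_kolPrime I hcm hΔ hK hodd hns hρ hM P₁ halt₁ hPx hnd₁ P₂
    halt₂ hnd₂ hCTV hcsupp₁ hcsupp₂ h3 hkol₀ y₀ hy0 hy u hu0 hu uu w h43 h44sel h44ord hι

/-! ### The same capstone with the value formula restricted to `2^{2M₀}`-torsion classes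

Appended by seat `bsd-line-gk2-p2` g12: `selmer_eq_and_card_selmer_twin_eq_of_kolPrime` VERBATIM, with `hCTV` assumed only for `t` with
`2^{2M₀} t = 0` — the only classes the telescope applies it to (Selmer eigenclasses independent of `x`,
Literature `exists_chain_of_casselsTate_of_torsion`), and the form in which the Cassels–Tate pairings pulled
back to `Sel_{2^M}` actually satisfy it. -/

/-- **`selmer_eq_and_card_selmer_twin_eq_of_kolPrime`, value formula on `2^{2M₀}`-torsion classes only** (extra antecedent
`2^{2M₀} t = 0` in `hCTV`; everything else verbatim). [cite: McCallumLMS1991, Prop. 5.2, Thm. 5.4, Cor. 5.6]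
[cite: Kolyvagin1989Izv, §3] -/
theorem selmer_eq_and_card_selmer_twin_eq_of_kolPrime_of_torsion (I : Input W K M hθ hθsq) (hcm : ¬ W.HasCM)
    (hΔ : W.Δ < 0) (hK : IsImaginaryQuadratic K) (hodd : Odd (NumberField.discr K))
    (hns : ¬ IsSquare ((NumberField.discr K : ℚ) * -|W.Δ|))
    (hρ : ∀ n : ℕ, W.HasSurjectiveModNGaloisRep (2 ^ n : ℕ)) [(twin W K).IsElliptic] (hM : 1 ≤ M)
    (P₁ : (visiblePair I).Sel₁ →+ (visiblePair I).Sel₁ →+ AddCircle (1 : ℚ)) (halt₁ : ∀ z, P₁ z z = 0)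
    (hPx : ∀ t, P₁ ⟨(visiblePair I).x, (visiblePair I).x_mem⟩ t = 0)
    (hnd₁ : ∀ z : (visiblePair I).Sel₁, (∀ t, P₁ z t = 0) →
      (z : galH1Torsion W (lvl M)) ∈ AddSubgroup.zmultiples (visiblePair I).x)
    (P₂ : (visiblePair I).Sel₂ →+ (visiblePair I).Sel₂ →+ AddCircle (1 : ℚ)) (halt₂ : ∀ z, P₂ z z = 0)
    (hnd₂ : ∀ z : (visiblePair I).Sel₂, (∀ t, P₂ z t = 0) → z = 0)
    (hCTV : ∀ ℓ m : ℕ, (visiblePair I).Kol ℓ → KolSupp (visiblePair I).Kol (ℓ * m) → ¬ ℓ ∣ m →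
      ∀ (j N a b : ℕ) (t : galH1Torsion W (lvl M) × galH1Torsion (twin W K) (lvl M))
        (ht : t ∈ (visiblePair I).toVisibleSplit.Sel)
        (hz : (((visiblePair I).p : ℤ) ^ j) • (visiblePair I).toVisibleSplit.c (ℓ * m) ∈
          (visiblePair I).toVisibleSplit.Sel),
      (((visiblePair I).p : ℤ) ^ N) • t = 0 → (((visiblePair I).p : ℤ) ^ (2 * (visiblePair I).M₀)) • t = 0 →
      t ∈ (visiblePair I).toVisibleSplit.part (1 * (-1) ^ (ℓ * m).primeFactors.card) →
      (∀ q ∈ m.primeFactors, t ∈ (visiblePair I).toVisibleSplit.A q) →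
      (visiblePair I).M - (visiblePair I).M₀ ≤ j → N + (visiblePair I).M₀ ≤ (visiblePair I).M → N ≤ j →
      a + b + 1 = N →
      (((visiblePair I).p : ℤ) ^ (a + (j - N))) • (visiblePair I).toVisibleSplit.c m ∉
        (visiblePair I).toVisibleSplit.A ℓ →
      (((visiblePair I).p : ℤ) ^ b) • t ∉ (visiblePair I).toVisibleSplit.A ℓ →
      (visiblePair I).prodPairing P₁ P₂ ⟨_, hz⟩ ⟨t, ht⟩ ≠ 0)
    (hcsupp₁ : ∀ n, KolSupp (visiblePair I).Kol n → Even n.primeFactors.card →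
      ∀ v, (∀ q, (visiblePair I).Kol q → v ≠ (visiblePair I).pl q) → (visiblePair I).c₁ n ∈ (visiblePair I).Loc₁ v)
    (hcsupp₂ : ∀ n, KolSupp (visiblePair I).Kol n → Odd n.primeFactors.card →
      ∀ v, (∀ q, (visiblePair I).Kol q → v ≠ (visiblePair I).pl q) → (visiblePair I).c₂ n ∈ (visiblePair I).Loc₂ v)
    (h3 : 3 * I.M₀ ≤ M)
    -- the shallow certificate and its level-`2` data (no visibility hypothesis, no auxiliary class)
    {ℓ₀ : ℕ} (hkol₀ : kolPrime W K 1 ℓ₀) (y₀ : galH1Torsion (twin W K) (lvl 1)) (hy0 : y₀ ≠ 0)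
    (hy : y₀ ∈ selmerGroup (twin W K) (lvl 1))
    (uu : ℕ → galH1Torsion W (lvl 1)) (w : ℕ → galH1Torsion (twin W K) (lvl 1))
    (h43 : ∀ ℓ, kolPrime W K M ℓ → ℓ ≠ ℓ₀ → ∀ v, v ≠ pl ℓ₀ → v ≠ pl ℓ → uu ℓ ∈ loc₁ W 1 v)
    (h44sel : ∀ ℓ, kolPrime W K M ℓ → ℓ ≠ ℓ₀ → (uu ℓ ∈ loc₁ W 1 (pl ℓ) ↔ y₀ ∈ a₂ W K 1 ℓ))
    (h44ord : ∀ ℓ, kolPrime W K M ℓ → ℓ ≠ ℓ₀ → (uu ℓ ∈ a₁ W 1 ℓ₀ ↔ w ℓ ∈ a₂ W K 1 ℓ₀))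
    (hι : ∀ ℓ, kolPrime W K M ℓ →
      torsionH1OfDvd (twin W K) (lvl_one_dvd_lvl hM) (w ℓ) = ((2 : ℤ) ^ (M - 1)) • I.c₂ ℓ) :
    selmerGroup W (lvl M) = AddSubgroup.zmultiples I.x ∧
      Nat.card (selmerGroup (twin W K) (lvl M)) = 2 ^ (2 * I.M₀) := by
  obtain ⟨u, hu0, hu⟩ := exists_aux_class W K hΔ hkol₀
  exact selmer_eq_and_card_selmer_twin_eq_of_shallow_kolPrime_of_torsion I hcm hΔ hK hodd hns hρ hM P₁ halt₁ hPx hnd₁ P₂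
    halt₂ hnd₂ hCTV hcsupp₁ hcsupp₂ h3 hkol₀ y₀ hy0 hy u hu0 hu uu w h43 h44sel h44ord hι

end Summit.BirchSwinnertonDyer.BirchSwinnertonDyer.Theorems.GenusExact.VisiblePairAtTwo
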